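import Summits.NavierStokesRegularity.NavierStokesRegularity.Theorems.TerminalTraceTypeITraceScarL3ApexPackageTranslate
import Literature.Analysis.FluidPDE.Seregin2020CubicLowerBound
import Literature.Analysis.FluidPDE.LocalTypeI
import HarnessLib

/-!
# The LOUD dust is SPARSE: a uniform cubic floor at every top singular point, and the packing law
# (item `TerminalTrace.TypeITraceScarL3`, stmt-NavierStokesRegularity-18385; ROUND-26 §3a (S3) / §3c, kernel)

Seat ns-typeII-p3 g10 (cell ns-regularity-ideate), `--supports stmt-NavierStokesRegularity-18385` (helper).
For the extinct Type-I apex package of line `annulus-dichotomy` (suitable in every `Q(a)` at the origin, weak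
gradient, `𝐈(Q(a)) ≤ M`, `D(z₀, r) ≤ D₀` at apices `z₀.1 ≤ 0`, rate `C/√(−s)`):

* `exists_cknC_ge_of_topSingular` — **UNIFORM CUBIC FLOOR**: there is `κ = κ(D₀) > 0` (Seregin's
  ε-regularity constant in the `(C, D)` form with the pressure decay iterated, PROVED in the tree:
  `Seregin2020.exists_le_cknC_of_isBackwardSingularPoint`) such that at EVERY top singular point `x` and EVERY
  radius `r > 0`: `C(r; (0,x)) = r⁻² ∫∫_{Q_r((0,x))} |U|³ ≥ κ` — all scales, because the package lives on every
  `Q(a)` (`Q_r((0,x)) ⊆ Q_{r+|x|}(0)`, the A/E parts finite by `𝐈 ≤ M`).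
* `card_mul_le_lintegral_cube_of_separated` — **PACKING LAW (cubic form)**: if `F` is a finite `2r`-separated
  set of top singular points in `B̄(0, ρ)`, the cylinders `Q_r((0,x))`, `x ∈ F`, are disjoint and lie in the
  slab `]−r², 0[ × B(0, ρ + r)`, so `#F · κ r² ≤ ∫_{−r²}^{0}∫_{B(0,ρ+r)} |U|³`.
* `lintegral_cube_slab_le_of_rate` — **RATE WEIGHTING**: by the Type-I rate, `∫∫_{]−r²,0[×B} |U|³ ≤
  ∫_{−r²}^{0} (C/√(−s)) E_B(s) ds` with the local energy `E_B(s) = ∫_B |U(s)|²` (Tonelli, no measurability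
  needed: `lintegral_prod_le`); assembled in `card_mul_le_rateWeighted_energy_of_separated`:
  `#F · κ r² ≤ ∫_{−r²}^{0} (C/√(−s)) E_{ρ+r}(s) ds`.

THE NUMBER (ROUND-26 §3c) in kernel form: an extinction rate `E_{ρ+r}(s) ≤ C_E (−s)^β` gives
`#F ≲ r^{2β−1}`, i.e. the `2r`-packing number of the top singular dust in `B̄_ρ` is `O(r^{2β−1})` — bounded
for the Type-I-saturated rate `β = 1/2` (finitely many points per ball: no loud dust), `dim_B ≤ 1 − 2β` in
general.  WHAT THIS IS NOT: not Stub QA / LOUD, not NS regularity, no rate is proved here.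
[cite: Seregin2014, Prop. 6.20 (p. 126) (ε-regularity in the (C,D) form); CaffarelliKohnNirenberg1982 §6]
-/

noncomputable section

set_option linter.dupNamespace false

namespace Summit.NavierStokesRegularity.NavierStokesRegularity.Theorems.TypeITraceScarL3

open MeasureTheory Set Function Filter Topology Metric
open Literature.Analysis.FluidPDE
open scoped NNReal ENNReal InnerProductSpace RealInnerProductSpace

/-! ### The uniform cubic floor at every top singular point -/

/-- **UNIFORM CUBIC FLOOR AT THE TOP SINGULAR DUST.**  For every pressure level `D₀` there is `κ > 0` such
that, for every extinct Type-I apex package `(U, P, G)` of a class `(M, D₀, C)` (suitable in every `Q(a)` at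
the origin, weak gradient on every `Q(a)`, `𝐈(Q(a)) ≤ M`, `D(z₀, r) ≤ D₀` at apices `z₀.1 ≤ 0`), at every
top singular point `x` and every radius `r > 0`: `κ ≤ C(r; (0, x)) = r⁻²∫∫_{Q_r((0,x))} |U|³`.  (Seregin's
ε-regularity in the `(C, D)` form, tree theorem `Seregin2020.exists_le_cknC_of_isBackwardSingularPoint`, run in
`Q_{r+|x|}(0) ⊇ Q_r((0,x))`; the rate and the top trace are not used.)
[cite: Seregin2014, Prop. 6.20 (p. 126)] -/
theorem exists_cknC_ge_of_topSingular (D₀ : ℝ≥0) : ∃ κ : ℝ, 0 < κ ∧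
    ∀ (U : ℝ → EuclideanSpace ℝ (Fin 3) → EuclideanSpace ℝ (Fin 3))
      (P : ℝ → EuclideanSpace ℝ (Fin 3) → ℝ)
      (G : ℝ → EuclideanSpace ℝ (Fin 3) → EuclideanSpace ℝ (Fin 3) →L[ℝ] EuclideanSpace ℝ (Fin 3))
      (M : ℝ≥0),
      (∀ a : ℝ, 0 < a →
        IsSuitableWeakSolutionInBall a (0 : ℝ × EuclideanSpace ℝ (Fin 3)) U P) →
      (∀ a : ℝ, 0 < a →
        HasWeakSpatialGradientOn
          (parabolicCylinderOpens a (0 : ℝ × EuclideanSpace ℝ (Fin 3))) U G) →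
      (∀ a : ℝ, 0 < a →
        typeIBound (parabolicCylinder a (0 : ℝ × EuclideanSpace ℝ (Fin 3))) U P G ≤ M) →
      (∀ z₀ : ℝ × EuclideanSpace ℝ (Fin 3), z₀.1 ≤ 0 →
        ∀ r : ℝ, 0 < r → cknD r z₀ P ≤ D₀) →
      ∀ x : EuclideanSpace ℝ (Fin 3), IsBackwardSingularPoint U ((0 : ℝ), x) →
        ∀ r : ℝ, 0 < r → ENNReal.ofReal κ ≤ cknC r (((0 : ℝ), x) : ℝ × EuclideanSpace ℝ (Fin 3)) U := by
  obtain ⟨κ, hκ, H⟩ := Seregin2020.exists_le_cknC_of_isBackwardSingularPoint D₀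
  refine ⟨κ, hκ, fun U P G M hsw hG hI hD x hx r hr => ?_⟩
  have hax : 0 < r + ‖x‖ := add_pos_of_pos_of_nonneg hr (norm_nonneg x)
  have hsub : parabolicCylinder r (((0 : ℝ), x) : ℝ × EuclideanSpace ℝ (Fin 3)) ⊆
      (parabolicCylinderOpens (r + ‖x‖) (0 : ℝ × EuclideanSpace ℝ (Fin 3)) :
        Set (ℝ × EuclideanSpace ℝ (Fin 3))) :=
    parabolicCylinder_top_subset_zero x hr
  -- the A and E parts are finite at `(0, x)`: `A_ess + C + D_osc + E ≤ 𝐈(Q_{r+|x|}) ≤ M`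
  have hsum : abScaledSum r (((0 : ℝ), x) : ℝ × EuclideanSpace ℝ (Fin 3)) U P G ≤ M :=
    (abScaledSum_le_typeIBound hr (parabolicCylinder_top_subset_zero x hr)).trans (hI _ hax)
  have hMtop : (M : ℝ≥0∞) ≠ ∞ := ENNReal.coe_ne_top
  have hA : cknAEss r (((0 : ℝ), x) : ℝ × EuclideanSpace ℝ (Fin 3)) U ≠ ∞ := by
    refine ne_top_of_le_ne_top hMtop (le_trans ?_ hsum)
    unfold abScaledSum
    exact le_add_right (le_add_right (le_add_right le_rfl))
  have hE : cknE r (((0 : ℝ), x) : ℝ × EuclideanSpace ℝ (Fin 3)) G ≠ ∞ := by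
    refine ne_top_of_le_ne_top hMtop (le_trans ?_ hsum)
    unfold abScaledSum
    exact le_add_self
  have hD' : ∀ r' ∈ Ioc (0 : ℝ) r, cknD r' (((0 : ℝ), x) : ℝ × EuclideanSpace ℝ (Fin 3)) P ≤ D₀ :=
    fun r' hr' => hD _ le_rfl r' hr'.1
  exact H _ U P G (hsw _ hax).1 (hG _ hax) _ r hr hsub hA hE hD' hx r ⟨hr, le_rfl⟩

/-! ### The packing law -/

/-- **PACKING LAW (cubic form).**  If `κ ≤ C(r; (0,x))` for every `x ∈ F` (e.g. the cubic floor at top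
singular points) and the finite set `F ⊆ B̄(0, ρ)` is `2r`-separated, then the backward cylinders
`Q_r((0,x))`, `x ∈ F`, are pairwise disjoint and contained in the slab `]−r², 0[ × B(0, ρ + r)`, whence
`#F · κ · r² ≤ ∫∫_{]−r²,0[ × B(0,ρ+r)} |U|³`. [folklore; CaffarelliKohnNirenberg1982 §6 (covering argument)] -/
theorem card_mul_le_lintegral_cube_of_separated
    {U : ℝ → EuclideanSpace ℝ (Fin 3) → EuclideanSpace ℝ (Fin 3)} {κ ρ r : ℝ} (hr : 0 < r)
    (F : Finset (EuclideanSpace ℝ (Fin 3)))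
    (hFρ : ∀ x ∈ F, ‖x‖ ≤ ρ)
    (hFκ : ∀ x ∈ F, ENNReal.ofReal κ ≤ cknC r (((0 : ℝ), x) : ℝ × EuclideanSpace ℝ (Fin 3)) U)
    (hsep : (↑F : Set (EuclideanSpace ℝ (Fin 3))).Pairwise fun x y => 2 * r ≤ dist x y) :
    (F.card : ℝ≥0∞) * (ENNReal.ofReal κ * ENNReal.ofReal (r ^ 2)) ≤
      ∫⁻ z in Ioo (-r ^ 2) 0 ×ˢ ball (0 : EuclideanSpace ℝ (Fin 3)) (ρ + r), ‖U z.1 z.2‖ₑ ^ 3 := by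
  classical
  have hr2 : ENNReal.ofReal (r ^ 2) ≠ 0 := (ENNReal.ofReal_pos.2 (by positivity)).ne'
  have hr2' : ENNReal.ofReal (r ^ 2) ≠ ⊤ := ENNReal.ofReal_ne_top
  -- each cylinder carries `κ r²`
  have hcyl : ∀ x ∈ F, ENNReal.ofReal κ * ENNReal.ofReal (r ^ 2) ≤
      ∫⁻ z in parabolicCylinder r (((0 : ℝ), x) : ℝ × EuclideanSpace ℝ (Fin 3)), ‖U z.1 z.2‖ₑ ^ 3 := by
    intro x hx
    have h := hFκ x hx
    unfold cknC at h
    rw [ENNReal.ofReal_pow hr.le]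
    calc ENNReal.ofReal κ * ENNReal.ofReal r ^ 2
        ≤ ((ENNReal.ofReal r ^ 2)⁻¹ *
            ∫⁻ z in parabolicCylinder r (((0 : ℝ), x) : ℝ × EuclideanSpace ℝ (Fin 3)),
              ‖U z.1 z.2‖ₑ ^ 3) * ENNReal.ofReal r ^ 2 := mul_le_mul' h le_rfl
      _ = ∫⁻ z in parabolicCylinder r (((0 : ℝ), x) : ℝ × EuclideanSpace ℝ (Fin 3)),
            ‖U z.1 z.2‖ₑ ^ 3 := by
          rw [mul_comm, ← mul_assoc, ENNReal.mul_inv_cancel (by rwa [← ENNReal.ofReal_pow hr.le])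
            (by rw [← ENNReal.ofReal_pow hr.le]; exact hr2'), one_mul]
  -- the cylinders are pairwise disjoint
  have hdisj : (↑F : Set (EuclideanSpace ℝ (Fin 3))).PairwiseDisjoint
      fun x => parabolicCylinder r (((0 : ℝ), x) : ℝ × EuclideanSpace ℝ (Fin 3)) := by
    intro x hx y hy hxy
    have hd : r + r ≤ dist x y := by have := hsep hx hy hxy; linarith
    exact (Disjoint.set_prod_right (ball_disjoint_ball hd) _ _)
  -- and contained in the slab
  have hsub : (⋃ x ∈ F, parabolicCylinder r (((0 : ℝ), x) : ℝ × EuclideanSpace ℝ (Fin 3))) ⊆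
      Ioo (-r ^ 2) 0 ×ˢ ball (0 : EuclideanSpace ℝ (Fin 3)) (ρ + r) := by
    intro z hz
    obtain ⟨x, hx, hzx⟩ := mem_iUnion₂.1 hz
    rw [mem_parabolicCylinder] at hzx
    obtain ⟨⟨h1, h2⟩, h3⟩ := hzx
    refine ⟨⟨by simpa using h1, by simpa using h2⟩, ?_⟩
    rw [mem_ball, dist_zero_right]
    calc ‖z.2‖ = dist z.2 0 := (dist_zero_right _).symm
      _ ≤ dist z.2 x + dist x 0 := dist_triangle _ _ _
      _ < r + ρ := add_lt_add_of_lt_of_le h3 (by rw [dist_zero_right]; exact hFρ x hx)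
      _ = ρ + r := add_comm _ _
  calc (F.card : ℝ≥0∞) * (ENNReal.ofReal κ * ENNReal.ofReal (r ^ 2))
      = ∑ _x ∈ F, ENNReal.ofReal κ * ENNReal.ofReal (r ^ 2) := by
        rw [Finset.sum_const, nsmul_eq_mul]
    _ ≤ ∑ x ∈ F, ∫⁻ z in parabolicCylinder r (((0 : ℝ), x) : ℝ × EuclideanSpace ℝ (Fin 3)),
          ‖U z.1 z.2‖ₑ ^ 3 := Finset.sum_le_sum hcyl
    _ = ∫⁻ z in ⋃ x ∈ F, parabolicCylinder r (((0 : ℝ), x) : ℝ × EuclideanSpace ℝ (Fin 3)),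
          ‖U z.1 z.2‖ₑ ^ 3 :=
        (lintegral_biUnion_finset hdisj (fun _ _ => (isOpen_parabolicCylinder _ _).measurableSet) _).symm
    _ ≤ ∫⁻ z in Ioo (-r ^ 2) 0 ×ˢ ball (0 : EuclideanSpace ℝ (Fin 3)) (ρ + r), ‖U z.1 z.2‖ₑ ^ 3 :=
        lintegral_mono_set hsub

/-! ### Rate weighting: the cubic slab integral against the local energy -/

/-- **RATE WEIGHTING.**  Under the Type-I rate `‖U(s, y)‖ ≤ C/√(−s)` (a.e. `y`, every `s < 0`):
`∫∫_{]a,0[ × B} |U|³ ≤ ∫_{a}^{0} (C/√(−s)) · ∫_B |U(s)|² ds` for every `a` and every set `B` (Tonelli's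
inequality `lintegral_prod_le`, then the rate slice by slice). [folklore] -/
theorem lintegral_cube_slab_le_of_rate
    {U : ℝ → EuclideanSpace ℝ (Fin 3) → EuclideanSpace ℝ (Fin 3)} {C : ℝ}
    (hrate : ∀ s : ℝ, s < 0 →
      ∀ᵐ y : EuclideanSpace ℝ (Fin 3), ‖U s y‖ ≤ C / Real.sqrt (-s))
    (a : ℝ) (B : Set (EuclideanSpace ℝ (Fin 3))) :
    ∫⁻ z in Ioo a 0 ×ˢ B, ‖U z.1 z.2‖ₑ ^ 3 ≤
      ∫⁻ s in Ioo a 0, ENNReal.ofReal (C / Real.sqrt (-s)) * ∫⁻ y in B, ‖U s y‖ₑ ^ 2 := by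
  rw [Measure.volume_eq_prod, ← Measure.prod_restrict]
  refine (lintegral_prod_le _).trans ?_
  refine lintegral_mono_ae ?_
  filter_upwards [ae_restrict_mem measurableSet_Ioo] with s hs
  have hrate_s : ∀ᵐ y ∂(volume.restrict B), ‖U s y‖ ≤ C / Real.sqrt (-s) :=
    ae_restrict_of_ae (hrate s hs.2)
  calc ∫⁻ y in B, ‖U (s, y).1 (s, y).2‖ₑ ^ 3
      ≤ ∫⁻ y in B, ENNReal.ofReal (C / Real.sqrt (-s)) * ‖U s y‖ₑ ^ 2 := by
        refine lintegral_mono_ae ?_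
        filter_upwards [hrate_s] with y hy
        have h1 : ‖U s y‖ₑ ≤ ENNReal.ofReal (C / Real.sqrt (-s)) := by
          rw [← ofReal_norm]; exact ENNReal.ofReal_le_ofReal hy
        calc ‖U (s, y).1 (s, y).2‖ₑ ^ 3 = ‖U s y‖ₑ * ‖U s y‖ₑ ^ 2 := by ring
          _ ≤ ENNReal.ofReal (C / Real.sqrt (-s)) * ‖U s y‖ₑ ^ 2 := mul_le_mul' h1 le_rfl
    _ = ENNReal.ofReal (C / Real.sqrt (-s)) * ∫⁻ y in B, ‖U s y‖ₑ ^ 2 :=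
        lintegral_const_mul' _ _ ENNReal.ofReal_ne_top

/-- **PACKING LAW, rate-weighted form (ROUND-26 §3a (S3) / §3c).**  For the apex package with rate `C/√(−s)`:
if `κ ≤ C(r; (0,x))` at every point of a finite `2r`-separated set `F ⊆ B̄(0, ρ)` (as supplied at top singular
points by `exists_cknC_ge_of_topSingular`), then
`#F · κ r² ≤ ∫_{−r²}^{0} (C/√(−s)) E_{ρ+r}(s) ds`, `E_R(s) = ∫_{B(0,R)} |U(s)|²`.  Consequence: an extinction
rate `E_{ρ+r}(s) ≤ C_E(−s)^β` bounds the `2r`-packing number of the top singular dust in `B̄(0,ρ)` by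
`O(r^{2β−1})`. [folklore; CaffarelliKohnNirenberg1982 §6] -/
theorem card_mul_le_rateWeighted_energy_of_separated
    {U : ℝ → EuclideanSpace ℝ (Fin 3) → EuclideanSpace ℝ (Fin 3)} {C κ ρ r : ℝ} (hr : 0 < r)
    (hrate : ∀ s : ℝ, s < 0 →
      ∀ᵐ y : EuclideanSpace ℝ (Fin 3), ‖U s y‖ ≤ C / Real.sqrt (-s))
    (F : Finset (EuclideanSpace ℝ (Fin 3)))
    (hFρ : ∀ x ∈ F, ‖x‖ ≤ ρ)
    (hFκ : ∀ x ∈ F, ENNReal.ofReal κ ≤ cknC r (((0 : ℝ), x) : ℝ × EuclideanSpace ℝ (Fin 3)) U)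
    (hsep : (↑F : Set (EuclideanSpace ℝ (Fin 3))).Pairwise fun x y => 2 * r ≤ dist x y) :
    (F.card : ℝ≥0∞) * (ENNReal.ofReal κ * ENNReal.ofReal (r ^ 2)) ≤
      ∫⁻ s in Ioo (-r ^ 2) 0, ENNReal.ofReal (C / Real.sqrt (-s)) *
        ∫⁻ y in ball (0 : EuclideanSpace ℝ (Fin 3)) (ρ + r), ‖U s y‖ₑ ^ 2 :=
  (card_mul_le_lintegral_cube_of_separated hr F hFρ hFκ hsep).trans
    (lintegral_cube_slab_le_of_rate hrate _ _)

end Summit.NavierStokesRegularity.NavierStokesRegularity.Theorems.TypeITraceScarL3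

end
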